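import Mathlib
import Summits.MatrixMultiplication.MatrixMultiplication.Theses.LevelGradedCohnUmans
import Literature.RepresentationTheory.FiniteGroups.CharacterDegrees

/-!
# Sketch — crux `GradedDesignFamily` (stmt-MatrixMultiplication-7610), crux-ideate round 1, ideator k = 2

First lemmas of the two crux idea cards

* `graded-simultaneity-wreath-lift` — graded SIMULTANEOUS designs (`JSTPPSeparated`, the
  Cohn–Kleinberg–Szegedy–Umans Def. 5.1 pattern read through a bi-invariant test space `J`) and the
  graded CKSU wreath lift `GradedSTPPFamilyAt ε → CruxAt ε` (statement `cruxAt_of_gradedSTPPFamilyAt`,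
  `sorry`; the single wreath step over Mathlib's `SemidirectProduct (Fin B → K) (Perm (Fin B))` is
  `wreathStep_separated`, `sorry`); the converse `gradedSTPPFamilyAt_of_cruxAt` (n = 1) is PROVED, and
  so is the packaging `gradedDesignFamily_iff_stpp` (crux ⇔ ∀ε, graded STPP family) modulo the lift.
* `quadratic-extension-level-one-cell` — the umbrella crux admits `GL_2(𝔽_Q)` for PRIME POWERS `Q`
  (the sibling Lie cruxes are typed over `ZMod p`); `cruxFamily_of_finiteFieldLevelOne` (the
  prime-power form of the route's `LevelOneLink`, `sorry`) and the ONE-SUBGROUP IDENTITY TEST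
  `oneSubgroup_separated_iff` (PROVED): with an outer SUBGROUP `H` and free middle/outer SETS `Y, Z`,
  `J`-separation of `(H, Y, Z)` is `|Z|` linear conditions instead of `|H||Z|`.

Everything is stated over the crux's own binders (its inline bi-invariance / separation / budget are
named `BiInvariant` / `JSeparated` / `gradedBudget`, each definitionally the inline expression;
`gradedDesignFamily_iff` is `Iff.rfl`).
-/

noncomputable section

open scoped BigOperators
open Literature.RepresentationTheory.FiniteGroups

namespace Summit.MatrixMultiplication.MatrixMultiplication.Cruxes.GradedDesignFamily.Ideator2

open Summit.MatrixMultiplication.MatrixMultiplication.Theses.LevelGradedCohnUmans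

/-! ## The crux's vocabulary, named -/

section Vocabulary

variable {G : Type} [Group G]

/-- Bi-invariance of a test space, as inlined in the crux. -/
def BiInvariant (J : Submodule ℂ (G → ℂ)) : Prop :=
  ∀ f ∈ J, ∀ a b : G, (fun g : G => f (a * g * b)) ∈ J

/-- Left-invariance (the half of bi-invariance the identity tests use). -/
def LeftInvariant (J : Submodule ℂ (G → ℂ)) : Prop :=
  ∀ f ∈ J, ∀ a : G, (fun g : G => f (a * g)) ∈ J

theorem BiInvariant.leftInvariant {J : Submodule ℂ (G → ℂ)} (h : BiInvariant J) :
    LeftInvariant J := by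
  intro f hf a
  have := h f hf a 1
  simpa using this

/-- `J`-separation of one triple, as inlined in the crux (two-implication form). -/
def JSeparated (J : Submodule ℂ (G → ℂ)) (X Y Z : Finset G) : Prop :=
  ∀ x₀ ∈ X, ∀ z₀ ∈ Z, ∃ f ∈ J, ∀ x ∈ X, ∀ y ∈ Y, ∀ y' ∈ Y, ∀ z ∈ Z,
    (x = x₀ ∧ y = y' ∧ z = z₀ → f (x⁻¹ * y * y'⁻¹ * z) = 1) ∧
    (¬ (x = x₀ ∧ y = y' ∧ z = z₀) → f (x⁻¹ * y * y'⁻¹ * z) = 0)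

/-- The graded budget `Σ_{χ ∈ Irr(G) ∩ J} χ(1)^s`, as inlined in the crux. -/
def gradedBudget [Fintype G] (J : Submodule ℂ (G → ℂ)) (s : ℝ) : ℝ :=
  ∑ᶠ χ ∈ irrChars G ∩ (J : Set (G → ℂ)), (χ 1).re ^ s

end Vocabulary

/-- The crux's existential clause AT ONE `ε` (verbatim body of `GradedDesignFamily`). -/
def CruxAt (ε : ℝ) : Prop :=
  ∃ (G : Type) (_ : Group G) (_ : Fintype G) (J : Submodule ℂ (G → ℂ)) (X Y Z : Finset G),
    (∀ f ∈ J, ∀ a b : G, (fun g : G => f (a * g * b)) ∈ J) ∧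
    (∀ x₀ ∈ X, ∀ z₀ ∈ Z, ∃ f ∈ J, ∀ x ∈ X, ∀ y ∈ Y, ∀ y' ∈ Y, ∀ z ∈ Z,
      (x = x₀ ∧ y = y' ∧ z = z₀ → f (x⁻¹ * y * y'⁻¹ * z) = 1) ∧
      (¬ (x = x₀ ∧ y = y' ∧ z = z₀) → f (x⁻¹ * y * y'⁻¹ * z) = 0)) ∧
    (∑ᶠ χ ∈ Literature.RepresentationTheory.FiniteGroups.irrChars G ∩ (J : Set (G → ℂ)),
      (χ 1).re ^ (2 + ε)) < ((X.card * Y.card * Z.card : ℕ) : ℝ) ^ ((2 + ε) / 3)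

/-- The crux is `∀ ε > 0, CruxAt ε`, by `Iff.rfl`. -/
theorem gradedDesignFamily_iff : GradedDesignFamily ↔ ∀ ε : ℝ, 0 < ε → CruxAt ε := Iff.rfl

/-! ## Card `graded-simultaneity-wreath-lift` -/

section Simultaneity

variable {G : Type} [Group G]

/-- **Graded simultaneous separation** of a family `(X i, Y i, Z i)_{i : ι}` by a test space `J`:
the Cohn–Kleinberg–Szegedy–Umans STPP pattern (Def. 5.1: pairs `(x, y) ∈ X_j × Y_j` and
`(y', z) ∈ Y_k × Z_k` share a block, the target `(x₀, z₀) ∈ X_i × Z_i` shares a block) read through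
ONE test per target: `f(x⁻¹ y y'⁻¹ z) = [j = i ∧ k = i ∧ x = x₀ ∧ y = y' ∧ z = z₀]`.
For a one-block family it is `JSeparated` (`jSTPPSeparated_const_iff`). It implies the tree's
`SimultaneousTPP` exactly as `JSeparated` implies the TPP (route item `SepImpliesTPP`). -/
def JSTPPSeparated {ι : Type} (J : Submodule ℂ (G → ℂ)) (X Y Z : ι → Finset G) : Prop :=
  ∀ i, ∀ x₀ ∈ X i, ∀ z₀ ∈ Z i, ∃ f ∈ J, ∀ j k, ∀ x ∈ X j, ∀ y ∈ Y j, ∀ y' ∈ Y k, ∀ z ∈ Z k,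
    ((j = i ∧ k = i ∧ x = x₀ ∧ y = y' ∧ z = z₀) → f (x⁻¹ * y * y'⁻¹ * z) = 1) ∧
    (¬ (j = i ∧ k = i ∧ x = x₀ ∧ y = y' ∧ z = z₀) → f (x⁻¹ * y * y'⁻¹ * z) = 0)

/-- One block: graded simultaneous separation is the crux's separation. -/
theorem jSTPPSeparated_const_iff (J : Submodule ℂ (G → ℂ)) (X Y Z : Finset G) :
    JSTPPSeparated J (fun _ : Fin 1 => X) (fun _ => Y) (fun _ => Z) ↔ JSeparated J X Y Z := by
  constructor
  · intro h x₀ hx₀ z₀ hz₀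
    obtain ⟨f, hfJ, hf⟩ := h 0 x₀ hx₀ z₀ hz₀
    refine ⟨f, hfJ, fun x hx y hy y' hy' z hz => ?_⟩
    have key := hf 0 0 x hx y hy y' hy' z hz
    refine ⟨fun hxyz => key.1 ⟨rfl, rfl, hxyz⟩, fun hxyz => key.2 ?_⟩
    rintro ⟨-, -, h'⟩
    exact hxyz h'
  · intro h i x₀ hx₀ z₀ hz₀
    obtain ⟨f, hfJ, hf⟩ := h x₀ hx₀ z₀ hz₀
    refine ⟨f, hfJ, fun j k x hx y hy y' hy' z hz => ?_⟩
    have key := hf x hx y hy y' hy' z hz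
    have hj : j = i := Subsingleton.elim _ _
    have hk : k = i := Subsingleton.elim _ _
    refine ⟨fun hall => key.1 hall.2.2, fun hnot => key.2 ?_⟩
    intro hxyz
    exact hnot ⟨hj, hk, hxyz⟩

end Simultaneity

/-- **Graded STPP family at exponent `2+ε`** (the Transfer `C⁺(ε)` of card
`graded-simultaneity-wreath-lift`): a finite group `H`, a bi-invariant test space `J`, and `n`
blocks, SIMULTANEOUSLY `J`-separated, whose `(2+ε)/3`-powers of volume out-sum the graded budget
`Σ_{χ ∈ Irr(H) ∩ J} χ(1)^{2+ε}` — "pay once for `n` designs". With `n = 1` it is `CruxAt ε`. -/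
def GradedSTPPFamilyAt (ε : ℝ) : Prop :=
  ∃ (H : Type) (_ : Group H) (_ : Fintype H) (J : Submodule ℂ (H → ℂ)) (n : ℕ)
    (X Y Z : Fin n → Finset H),
    BiInvariant J ∧ JSTPPSeparated J X Y Z ∧
    gradedBudget J (2 + ε) <
      ∑ i, ((((X i).card * (Y i).card * (Z i).card : ℕ) : ℝ) ^ ((2 + ε) / 3))

/-- The trivial direction of the Transfer: a single graded design is a one-block family. PROVED. -/
theorem gradedSTPPFamilyAt_of_cruxAt (ε : ℝ) : CruxAt ε → GradedSTPPFamilyAt ε := by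
  rintro ⟨G, instG, instF, J, X, Y, Z, hJ, hsep, hlt⟩
  refine ⟨G, instG, instF, J, 1, fun _ => X, fun _ => Y, fun _ => Z, hJ, ?_, ?_⟩
  · exact (jSTPPSeparated_const_iff J X Y Z).2 hsep
  · simpa [gradedBudget] using hlt

/-- **FIRST LEMMA of card `graded-simultaneity-wreath-lift` — the graded CKSU wreath lift.**
A graded STPP family at exponent `2+ε` yields a SINGLE graded design at exponent `2+ε`, i.e. the
crux's clause at `ε`: take the `N`-th tensor power of the family in `H^N` with `J^{⊗N}` (blocks =
words, simultaneously separated by products of separators), keep the `B = multinomial(N; μN)` words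
of one type `μ` (equal volumes `V_μ^N`, `V_μ = Π V_i^{μ_i}`), and lift à la CKSU Thm. 7.1 to the
permutation wreath product `(H^N)^B ⋊ S_B` with the bi-invariant test space
`J_wr = {F : F(·, π) ∈ (J^{⊗N})^{⊗B} ∀ π}` (`wreathStep_separated`): the lifted triple has volume
`(B!)³ V_μ^{NB}`, every `χ ∈ Irr ∩ J_wr` lies over `(Irr(H) ∩ J)^{NB}` so
`Σ_{Irr ∩ J_wr} χ(1)^{2+ε} ≤ (B!)^{1+ε} (Σ_{Irr(H) ∩ J} χ(1)^{2+ε})^{NB}`, and the crux inequality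
becomes `S_{2+ε}(H,J)^{NB} < B! · V_μ^{NB(2+ε)/3}`, i.e. `S_{2+ε} < (B!)^{1/(NB)} V_μ^{(2+ε)/3}
→ e^{H(μ)} V_μ^{(2+ε)/3}`; the Gibbs variational principle `sup_μ [H(μ) + Σ μ_i s_i] = log Σ e^{s_i}`
at `μ_i ∝ V_i^{(2+ε)/3}` turns this into the family inequality (strictness absorbs the rational
approximation of `μ` and the `poly(N)` in `B`). Constructive throughout; no `τ`-theorem needed on
this (design) side. -/
theorem cruxAt_of_gradedSTPPFamilyAt (ε : ℝ) (hε : 0 < ε) :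
    GradedSTPPFamilyAt ε → CruxAt ε := by
  sorry

/-- The Transfer packaged: modulo the lift, the crux is EQUIVALENT to "for every `ε > 0` some finite
group carries a graded STPP family at exponent `2+ε`" (the extra freedom is the number of blocks). -/
theorem gradedDesignFamily_iff_stpp
    (lift : ∀ ε : ℝ, 0 < ε → GradedSTPPFamilyAt ε → CruxAt ε) :
    GradedDesignFamily ↔ ∀ ε : ℝ, 0 < ε → GradedSTPPFamilyAt ε := by
  rw [gradedDesignFamily_iff]
  exact ⟨fun h ε hε => gradedSTPPFamilyAt_of_cruxAt ε (h ε hε), fun h ε hε => lift ε hε (h ε hε)⟩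

/-! ### The single wreath step, typed over Mathlib's semidirect product -/

section WreathStep

variable (K : Type) [Group K] (B : ℕ)

/-- The permutation wreath product `K ≀ S_B = (Fin B → K) ⋊ Perm(Fin B)`, `S_B` permuting
coordinates (`mulAutArrow`: `(π • k) b = k (π⁻¹ b)`), so that
`⟨k, π⟩ * ⟨k', π'⟩ = ⟨k · (k' ∘ π⁻¹), π π'⟩`. -/
abbrev Wr := (Fin B → K) ⋊[mulAutArrow] Equiv.Perm (Fin B)

variable {K B}

/-- Products of tests, one per coordinate: the span of `k ↦ Π_b f_b (k b)` with all `f_b ∈ J`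
(the test space `J^{⊗B}` on the base group `K^B`). -/
def piTests (J : Submodule ℂ (K → ℂ)) : Submodule ℂ ((Fin B → K) → ℂ) :=
  Submodule.span ℂ {F | ∃ f : Fin B → (K → ℂ), (∀ b, f b ∈ J) ∧ F = fun k => ∏ b, f b (k b)}

/-- The wreath test space `J_wr = {F : K ≀ S_B → ℂ | every slice F(·, π) lies in J^{⊗B}}`
(bi-invariant under `K ≀ S_B` when `J` is bi-invariant under `K`; `dim J_wr = B! · (dim J)^B`;
an irreducible character of `K ≀ S_B` lies in `J_wr` iff it lies over `(Irr K ∩ J)^B`, whence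
`χ(1) ≤ B! · δ^B` and `Σ_{Irr ∩ J_wr} χ(1)^{2+ε} ≤ (B!)^{1+ε} (Σ_{Irr K ∩ J} ψ(1)^{2+ε})^B`). -/
def wreathTests (J : Submodule ℂ (K → ℂ)) : Submodule ℂ (Wr K B → ℂ) :=
  ⨅ π : Equiv.Perm (Fin B),
    (piTests (B := B) J).comap
      (LinearMap.funLeft ℂ ℂ (fun k : Fin B → K => (⟨k, π⟩ : Wr K B)))

/-- The CKSU lift of a family of `B` blocks placed in the `B` coordinates:
`X̂ = (Π_b X_b) × S_B`, `Ŷ = (Π_b Y_b) × S_B`, `Ẑ = (Π_b Z_b) × S_B` (sizes `B! Π|X_b|` etc.). -/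
def liftSet [DecidableEq K] (X : Fin B → Finset K) : Finset (Wr K B) :=
  ((Fintype.piFinset X) ×ˢ (Finset.univ : Finset (Equiv.Perm (Fin B)))).image
    fun p => (⟨p.1, p.2⟩ : Wr K B)

/-- **The graded wreath step** (CKSU 2005, proof of Thm. 7.1, made graded): if `B` blocks in `K` are
simultaneously `J`-separated then their CKSU lift to `K ≀ S_B` is `J_wr`-separated. Computation:
`x⁻¹ y y'⁻¹ z = ⟨k, π⁻¹σσ'⁻¹τ⟩` with coordinate `b` of `k` equal to
`a(πb)⁻¹ b(πb) · b'(m b)⁻¹ c(m b)`, `m = σ'σ⁻¹π` — a same-block `A`-pair times a same-block `B`-pair,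
exactly the STPP pattern; the separator of the target `(⟨a⁰, π₀⟩, ⟨c⁰, τ₀⟩)` is
`F(k, ρ) = [ρ = π₀⁻¹τ₀] · Π_b f_b(k b)` with `f_b` the simultaneous separator of the target
`(a⁰(π₀ b), c⁰(π₀ b))` of block `π₀ b`; block matching at every coordinate forces `π = π₀`, `σ = σ'`,
then `τ = τ₀` and the coordinates. -/
theorem wreathStep_separated [DecidableEq K] (J : Submodule ℂ (K → ℂ)) (hJ : BiInvariant J)
    (X Y Z : Fin B → Finset K) (hsep : JSTPPSeparated J X Y Z) :
    JSeparated (wreathTests (B := B) J) (liftSet X) (liftSet Y) (liftSet Z) := by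
  sorry

end WreathStep

/-! ## Card `quadratic-extension-level-one-cell` -/

section FiniteField

variable (F : Type) [Field F] [Fintype F] [DecidableEq F]

/-- `GL_2` over an arbitrary finite field (the umbrella crux quantifies over ALL finite groups, so
prime powers `|F| = q^e` are admissible hosts; the sibling cruxes are typed over `ZMod p`). -/
abbrev GL2 := Matrix.GeneralLinearGroup (Fin 2) F

variable {F}

/-- Fourier-rank-`≤ 1` ("level one") separation over `F` for a chosen additive character `ψ`:
tests `f(g) = Σ_{rk M ≤ 1} c_M ψ(tr(M g))` = sums `Σ_u Φ_u(g·u)` of functions of ONE matrix–vector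
product (for any `ψ ≠ 1` the span is the same, the coefficient space of the permutation module
`ℂ[F²]`; `Irr ∩ F_1 = {1, St, π(θ,1) : θ ≠ 1}`, `dim = Q³+Q²−3Q−1`, budget `1 + Q^s + (Q−2)(Q+1)^s`,
`Q = |F|`). -/
def RankOneSeparated (ψ : AddChar F ℂ) (X Y Z : Finset (GL2 F)) : Prop :=
  ∀ x₀ ∈ X, ∀ z₀ ∈ Z, ∃ c : Matrix (Fin 2) (Fin 2) F → ℂ, (∀ M, 1 < M.rank → c M = 0) ∧
    ∀ x ∈ X, ∀ y ∈ Y, ∀ y' ∈ Y, ∀ z ∈ Z,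
      (∑ M : Matrix (Fin 2) (Fin 2) F, c M * ψ (Matrix.trace
        (M * ((x⁻¹ * y * y'⁻¹ * z : GL2 F) : Matrix (Fin 2) (Fin 2) F)))) =
        if x = x₀ ∧ y = y' ∧ z = z₀ then 1 else 0

end FiniteField

/-- **FIRST LEMMA (a) of card `quadratic-extension-level-one-cell` — prime-power universality of
the smallest Lie cell** (the route's `LevelOneLink` + `LieEngineLink` with `ZMod p` replaced by an
arbitrary finite field): rank-1-separated triples in `GL_2(F)` with `|X|, |Y|, |Z| ≥ c |F|^{3/2}`
along finite fields of unbounded order prove the crux for EVERY `ε`, because at fixed `(m,k) = (2,1)`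
the graded budget `1 + Q^{2+ε} + (Q−2)(Q+1)^{2+ε} ≤ 8 Q^{3+ε}` has `N_eff ≈ Q` equal blocks while
`V^{(2+ε)/3} ≥ c^{2+ε} Q^{3+3ε/2}` — the ratio `Q^{ε/2} c^{2+ε}/8` exceeds `1` for `Q` large. The host
`G = GL_2(F)` with `J = F_1(F)` (bi-invariant: `rk(bMa) = rk M`) is a legal witness of the umbrella
crux for prime powers `|F|`, which the `ZMod p`-typed sibling `LevelOneGL2Designs` cannot use. -/
theorem cruxFamily_of_finiteFieldLevelOne
    (h : ∃ c : ℝ, 0 < c ∧ ∀ N : ℕ, ∃ (F : Type) (_ : Field F) (_ : Fintype F) (_ : DecidableEq F)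
      (ψ : AddChar F ℂ), ψ ≠ 1 ∧ N ≤ Fintype.card F ∧
      ∃ X Y Z : Finset (Matrix.GeneralLinearGroup (Fin 2) F), RankOneSeparated ψ X Y Z ∧
        c * (Fintype.card F : ℝ) ^ (3 / 2 : ℝ) ≤ X.card ∧
        c * (Fintype.card F : ℝ) ^ (3 / 2 : ℝ) ≤ Y.card ∧
        c * (Fintype.card F : ℝ) ^ (3 / 2 : ℝ) ≤ Z.card) :
    GradedDesignFamily := by
  sorry

section OneSubgroup

variable {G : Type} [Group G]

/-- **FIRST LEMMA (b) — the ONE-SUBGROUP IDENTITY TEST.** If the outer set `X = H` is a SUBGROUP and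
`J` is left-invariant, `J`-separation of `(H, Y, Z)` for arbitrary SETS `Y, Z` collapses from
`|H||Z|` conditions to `|Z|`: one test `F_{z₀} ∈ J` per `z₀ ∈ Z` reading `δ_{z₀}` on the footprint
`H·(YY⁻¹)·Z` (translate every target `(x₀, z₀)` to `(1, z₀)` by `g ↦ F(x₀ g)`). The route's
`SubgroupIdentityLink` is the case where `Y, Z` are subgroups too; here the middle set is FREE, which
is where every level-one design needs its room. PROVED. -/
theorem oneSubgroup_separated_iff [Fintype G] [DecidableEq G] (J : Submodule ℂ (G → ℂ))
    (hJ : LeftInvariant J) (H : Subgroup G) [DecidablePred (· ∈ H)] (Y Z : Finset G) :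
    JSeparated J (Finset.univ.filter (· ∈ H)) Y Z ↔
      ∀ z₀ ∈ Z, ∃ F ∈ J, ∀ a ∈ H, ∀ y ∈ Y, ∀ y' ∈ Y, ∀ z ∈ Z,
        ((a = 1 ∧ y = y' ∧ z = z₀) → F (a * y * y'⁻¹ * z) = 1) ∧
        (¬ (a = 1 ∧ y = y' ∧ z = z₀) → F (a * y * y'⁻¹ * z) = 0) := by
  constructor
  · intro h z₀ hz₀
    have h1 : (1 : G) ∈ Finset.univ.filter (· ∈ H) := by simp [H.one_mem]
    obtain ⟨f, hfJ, hf⟩ := h 1 h1 z₀ hz₀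
    refine ⟨f, hfJ, fun a ha y hy y' hy' z hz => ?_⟩
    have ha' : a⁻¹ ∈ Finset.univ.filter (· ∈ H) := by simp [H.inv_mem ha]
    have key := hf a⁻¹ ha' y hy y' hy' z hz
    simp only [inv_inv, inv_eq_one] at key
    exact key
  · intro h x₀ hx₀ z₀ hz₀
    have hx₀H : x₀ ∈ H := by simpa using hx₀
    obtain ⟨Fz, hFJ, hF⟩ := h z₀ hz₀
    refine ⟨fun g => Fz (x₀ * g), hJ Fz hFJ x₀, fun x hx y hy y' hy' z hz => ?_⟩
    have hxH : x ∈ H := by simpa using hx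
    have key := hF (x₀ * x⁻¹) (H.mul_mem hx₀H (H.inv_mem hxH)) y hy y' hy' z hz
    have hmul : x₀ * x⁻¹ * y * y'⁻¹ * z = x₀ * (x⁻¹ * y * y'⁻¹ * z) := by group
    have hiff : (x₀ * x⁻¹ = 1) ↔ (x = x₀) := by
      rw [mul_inv_eq_one]; exact eq_comm
    rw [hmul, hiff] at key
    exact key

end OneSubgroup

end Summit.MatrixMultiplication.MatrixMultiplication.Cruxes.GradedDesignFamily.Ideator2
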